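import Mathlib
import Summits.Ventures.PercRepro2.HCov
import Summits.Ventures.PercRepro2.GcInterior

/-!
# The interior-weights reduction for ANY continuous form (blind cell PercRepro2, typer-1 g55)

`HCov_of_int` (`GcInterior.lean`) is the case `f = Gc` of a generic fact: a property
`0 ≤ f p` (or `f p ≤ g p`) with `f`, `g` continuous in the weights for the order topology of `R`
that holds at every INTERIOR weight (`IsIntVec p`: `0 < p e < 1`) holds at every admissible
weight (`IsProbVec p`), because the open cube is dense in the closed cube and the property is
closed. Any row of the cell whose two sides are sums of products of event probabilities — every
`prob`-built mass is continuous by `continuous_prob` — may therefore be proved at interior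
weights only, where every non-empty event has positive probability (`GcInteriorPos.lean`):

* `mem_closure_intVec` — every admissible weight vector is in the closure of the interior ones;
* **`forall_probVec_of_forall_intVec`** — a closed property holding on the interior holds on
  the cube (the topology is the order topology put on `R` by `Preorder.topology`);
* **`nonneg_of_int`**, **`le_of_int`** — the two usual shapes, with continuity hypotheses stated
  for an arbitrary `[TopologicalSpace R] [OrderTopology R]` (as `continuous_prob`, `continuous_Gc`
  are: `continuous_Gc …` itself discharges them);
* `prob_le_prob_of_int`, `prob_mul_le_of_int` — two instances: an inequality between two masses,
  or between two products of masses, at interior weights gives it at every weight.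
-/

namespace Summit.Ventures.PercRepro2

open CovForm

section Generic

variable {E : Type*} [Fintype E] {R : Type*} [Field R] [LinearOrder R] [IsStrictOrderedRing R]

omit [Fintype E] in
/-- Every admissible weight vector lies in the closure of the interior ones (order topology). -/
lemma mem_closure_intVec [TopologicalSpace R] [OrderTopology R] {p : E → R} (hp : IsProbVec p) :
    p ∈ closure {q : E → R | IsIntVec q} := by
  have hset : {q : E → R | IsIntVec q} = Set.pi Set.univ (fun _ : E => Set.Ioo (0 : R) 1) :=
    Set.ext fun q => isIntVec_iff_mem_pi
  rw [hset, closure_pi_set]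
  have hp' := isProbVec_iff_mem_pi.1 hp
  rw [Set.mem_univ_pi] at hp' ⊢
  intro e
  rw [closure_Ioo zero_ne_one]
  exact hp' e

omit [Fintype E] in
/-- **The generic interior reduction**: a property of the weights that is closed for the order
topology and holds at every interior weight holds at every admissible weight. -/
theorem forall_probVec_of_forall_intVec (P : (E → R) → Prop)
    (hP : ∀ [TopologicalSpace R] [OrderTopology R], IsClosed {q : E → R | P q})
    (h : ∀ q : E → R, IsIntVec q → P q) : ∀ p : E → R, IsProbVec p → P p := by
  intro p hp
  letI : TopologicalSpace R := Preorder.topology R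
  haveI : OrderTopology R := ⟨rfl⟩
  exact hP.closure_subset_iff.2 (fun q hq => h q hq) (mem_closure_intVec hp)

omit [Fintype E] in
/-- **`0 ≤ f` at interior weights gives `0 ≤ f` at every admissible weight** for `f` continuous
in the weights (any `[TopologicalSpace R] [OrderTopology R]`, as `continuous_Gc`). -/
theorem nonneg_of_int (f : (E → R) → R)
    (hf : ∀ [TopologicalSpace R] [OrderTopology R], Continuous f)
    (h : ∀ q : E → R, IsIntVec q → 0 ≤ f q) : ∀ p : E → R, IsProbVec p → 0 ≤ f p :=
  forall_probVec_of_forall_intVec (fun q => 0 ≤ f q)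
    (isClosed_le continuous_const hf) h

omit [Fintype E] in
/-- **`f ≤ g` at interior weights gives `f ≤ g` at every admissible weight** for `f`, `g`
continuous in the weights. -/
theorem le_of_int (f g : (E → R) → R)
    (hf : ∀ [TopologicalSpace R] [OrderTopology R], Continuous f)
    (hg : ∀ [TopologicalSpace R] [OrderTopology R], Continuous g)
    (h : ∀ q : E → R, IsIntVec q → f q ≤ g q) : ∀ p : E → R, IsProbVec p → f p ≤ g p :=
  forall_probVec_of_forall_intVec (fun q => f q ≤ g q)
    (isClosed_le hf hg) h

variable [DecidableEq E]

/-- An inequality between two event masses at interior weights holds at every admissible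
weight. -/
theorem prob_le_prob_of_int (A B : Set (Config E))
    (h : ∀ q : E → R, IsIntVec q → prob q A ≤ prob q B) :
    ∀ p : E → R, IsProbVec p → prob p A ≤ prob p B :=
  le_of_int (fun q => prob q A) (fun q => prob q B) (continuous_prob A) (continuous_prob B) h

/-- An inequality between two products of event masses at interior weights holds at every
admissible weight. -/
theorem prob_mul_le_of_int (A B C D : Set (Config E))
    (h : ∀ q : E → R, IsIntVec q → prob q A * prob q B ≤ prob q C * prob q D) :
    ∀ p : E → R, IsProbVec p → prob p A * prob p B ≤ prob p C * prob p D :=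
  le_of_int (fun q => prob q A * prob q B) (fun q => prob q C * prob q D)
    ((continuous_prob A).mul (continuous_prob B)) ((continuous_prob C).mul (continuous_prob D)) h

end Generic

end Summit.Ventures.PercRepro2
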